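import Summits.ResolutionOfSingularities.ResolutionOfSingularities.Theorems.FrobeniusLadderFInjectiveMacaulayficationRelGddF008Cone
import Summits.ResolutionOfSingularities.ResolutionOfSingularities.Theorems.FrobeniusLadderFInjectiveMacaulayficationRelGddF008Regular
import Summits.ResolutionOfSingularities.ResolutionOfSingularities.Theorems.FrobeniusLadderFInjectiveMacaulayficationRelGddF008Hpow
import Summits.ResolutionOfSingularities.ResolutionOfSingularities.Theorems.FrobeniusLadderFInjectiveMacaulayficationFilteredConeFiModelRel
import Literature.AlgebraicGeometry.Resolution.ComponentGluing
import Literature.AlgebraicGeometry.HodgeTheory.CycleClassPrincipalDivisorProjectiveSpaceHolds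
import HarnessLib

/-!
# ★ RGDD-L row F008 at `p = 5`: ONE `(2,3,9,3 | 0)`-WEIGHTED BLOW-UP ALONG THE `t`-AXIS F-INJECTIVELY MACAULAYFIES THE FOURFOLD
# `z² + (y² + x³)³ + x¹¹ + w⁷ + t·x³y·w³ + t²·z·w³ = 0` — the first RELATIVE (non-isolated bad locus) `d = 4` instance in the tree
# (crux `FInjectiveMacaulayfication` stmt-ResolutionOfSingularities-15315, relative filtered engine `FilteredConeFiModelRel`;
# RULING R15.39 (2) + ERRATUM 18:55:29Z + R15.44 (2) + R15.45 + R15.48 (4) of res-L1-w45a-plan-1)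

Support file for crux stmt-ResolutionOfSingularities-15315 (`FrobeniusLadder.FInjectiveMacaulayfication`), chain w45a, seat
res-L1-w45a-stub-1 g6 (assembly). [OURS · L1 W4.5a; mechanism KNOWN-IN-TREE = the relative filtered engine
`FilteredConeFiModelRel.filteredConeFiModelRel_affineBlowup` (res-L1-w45a-lead-1); specimen = RGDD-L row F008 (res-L1-w45a-idea-2, (P)
certificate by machine; hpow decided by res-L1-w45a-tri-1 and typed by res-L1-w45a-stub-4 `RelGddF008Hpow`); inputs `RelGddF008Data`,
`RelGddF008Cone` (stub-1), `RelGddF008Regular` (res-L1-w45a-stub-2)] — NOT a statement of the manuscript [claim: Hironaka2017];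
AI-written, weaker than expert review.

**The specimen.** `F008 = T₁₁ + t·x³y·w³ + t²·z·w³ ⊂ 𝔸⁵_k`, `T₁₁ = z² + (y² + x³)³ + x¹¹ + w⁷` (`x,y,z,w,t = X₀,…,X₄`), `char k = 5`:
an integral fourfold hypersurface whose singular (= non-FULL) locus is the whole `t`-axis `L = V(x,y,z,w)` — a CURVE of bad points, the
regime where point blow-ups are useless and the crux's why-fail («die once the bad locus is a curve») lives.  After the GRADED
coordinate change `σ : z ↦ z + 2t²w³` (`RelGddF008Data.sigma_f008_eq`: `σ(F008) = g` in characteristic `5`) the equation is the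
diagonal form `g = z² + t⁴w⁶ + φ³ + x¹¹ + w⁷ + t·x³y·w³`, `φ = y² + x³`, with `(2,3,9,3 | 0)`-initial form
`g₀ = z² + t⁴w⁶ + φ³ + t·x³y·w³` (weight `18`) along `L`.

**The theorems.**
* `g_relGddModel_char5` — the NAMED MODEL: every stalk of the weighted blow-up `affineBlowup (I₁₈·k[X]/(g))`, `I₁₈ = (monomials of
  (2,3,9,3,0)-weight ≥ 18) ⊂ (x,y,z,w)`, is a domain in which every system of parameters is weakly regular and generates a
  Frobenius-closed ideal (= `filteredConeFiModelRel_affineBlowup` fed with `RelGddF008Hpow.hpow_2393_18`, `RelGddF008Data` (initial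
  form, order `18`, primality, `x̄ᵥ ≠ 0`), `RelGddF008Regular.g_offL_clause_char5` (`hoff`: regular off `L`) and
  `RelGddF008Cone.g0_offL_clause_char5` (`hoff₀`: the cone is FULL off `L`));
* `g_relGdd_char5` — the `∃`-form (crux-statement currency) for `Spec k[X]/(g)`; `g_relGdd_strongPlusStep_char5` — the
  hole-#3 `∃`-clause (`stub_confinedIsoStepStrongPlus` shape) at the generic point of `L`;
* ★ `f008_fInjectiveMacaulayfication_char5` — the conclusion of `FrobeniusLadder.FInjectiveMacaulayfication` for
  `X = Spec k[X₀,…,X₄]/(F008)` VERBATIM, over every field of characteristic `5`, transported along `σ`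
  (`Ideal.quotientEquivAlg` + `isBirational_of_isIso`, as in `GxzGradedFiModel`).

No definitions, no named facts, no `decide` tables. [folklore mechanism: deformation to the weighted normal cone along `L`]
-/

-- single-problem summit: the doubled namespace component is forced
set_option linter.dupNamespace false

noncomputable section

open AlgebraicGeometry CategoryTheory MvPolynomial
open Literature.AlgebraicGeometry.Resolution

namespace Summit.ResolutionOfSingularities.ResolutionOfSingularities.Theorems.FInjectiveMacaulayfication.RelGddF008

open Summit.ResolutionOfSingularities.ResolutionOfSingularities.Theorems.FInjectiveMacaulayfication

/-- The weight/chart data of the facet `(2,3,9,3 | 0)`, `N = 18`, `c = (9,6,2,6)` on `J = {0,1,2,3}`. [folklore] -/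
theorem hwc_2393 : ∀ v ∈ ({0, 1, 2, 3} : Finset (Fin 5)),
    0 < (![2, 3, 9, 3, 0] : Fin 5 → ℕ) v ∧ (![9, 6, 2, 6, 0] : Fin 5 → ℕ) v * (![2, 3, 9, 3, 0] : Fin 5 → ℕ) v = 18 := by
  intro v hv
  fin_cases v <;> simp_all

/-- The weights vanish off `J = {0,1,2,3}` (the `t`-direction has weight `0`). [folklore] -/
theorem hw0_2393 : ∀ v : Fin 5, v ∉ ({0, 1, 2, 3} : Finset (Fin 5)) → (![2, 3, 9, 3, 0] : Fin 5 → ℕ) v = 0 := by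
  intro v hv
  fin_cases v <;> simp_all

/-- **THE NAMED MODEL for the diagonal form `g` at `p = 5`**: every stalk of the `(2,3,9,3 | 0)`-weighted blow-up `affineBlowup (I₁₈·k[X]/(g))` along the
`t`-axis is a domain satisfying the per-stalk clause of the crux. [folklore] -/
theorem g_relGddModel_char5 (k : Type) [Field k] [CharP k 5] (g g₀ : MvPolynomial (Fin 5) k)
    (hg : g = X 2 ^ 2 + X 4 ^ 4 * X 3 ^ 6 + (X 1 ^ 2 + X 0 ^ 3) ^ 3 + X 4 * X 0 ^ 3 * X 1 * X 3 ^ 3 + X 0 ^ 11 + X 3 ^ 7)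
    (hg₀ : g₀ = X 2 ^ 2 + X 4 ^ 4 * X 3 ^ 6 + (X 1 ^ 2 + X 0 ^ 3) ^ 3 + X 4 * X 0 ^ 3 * X 1 * X 3 ^ 3) :
    ∀ y : ↥(affineBlowup ((Ideal.span {m : MvPolynomial (Fin 5) k | ∃ b : Fin 5 →₀ ℕ,
        18 ≤ Finsupp.weight (![2, 3, 9, 3, 0] : Fin 5 → ℕ) b ∧ m = MvPolynomial.monomial b 1}).map (Ideal.Quotient.mk (Ideal.span {g})))),
      IsDomain ((affineBlowup ((Ideal.span {m : MvPolynomial (Fin 5) k | ∃ b : Fin 5 →₀ ℕ,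
        18 ≤ Finsupp.weight (![2, 3, 9, 3, 0] : Fin 5 → ℕ) b ∧ m = MvPolynomial.monomial b 1}).map
          (Ideal.Quotient.mk (Ideal.span {g})))).presheaf.stalk y) ∧
      ∀ d : ℕ, ringKrullDim ((affineBlowup ((Ideal.span {m : MvPolynomial (Fin 5) k | ∃ b : Fin 5 →₀ ℕ,
        18 ≤ Finsupp.weight (![2, 3, 9, 3, 0] : Fin 5 → ℕ) b ∧ m = MvPolynomial.monomial b 1}).map
          (Ideal.Quotient.mk (Ideal.span {g})))).presheaf.stalk y) = d →
        ∀ s : Fin d → (affineBlowup ((Ideal.span {m : MvPolynomial (Fin 5) k | ∃ b : Fin 5 →₀ ℕ,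
          18 ≤ Finsupp.weight (![2, 3, 9, 3, 0] : Fin 5 → ℕ) b ∧ m = MvPolynomial.monomial b 1}).map
            (Ideal.Quotient.mk (Ideal.span {g})))).presheaf.stalk y,
          (Ideal.span (Set.range s)).radical.IsMaximal →
          RingTheory.Sequence.IsWeaklyRegular ((affineBlowup ((Ideal.span {m : MvPolynomial (Fin 5) k | ∃ b : Fin 5 →₀ ℕ,
            18 ≤ Finsupp.weight (![2, 3, 9, 3, 0] : Fin 5 → ℕ) b ∧ m = MvPolynomial.monomial b 1}).map
              (Ideal.Quotient.mk (Ideal.span {g})))).presheaf.stalk y) (List.ofFn s) ∧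
          ∀ z : (affineBlowup ((Ideal.span {m : MvPolynomial (Fin 5) k | ∃ b : Fin 5 →₀ ℕ,
            18 ≤ Finsupp.weight (![2, 3, 9, 3, 0] : Fin 5 → ℕ) b ∧ m = MvPolynomial.monomial b 1}).map
              (Ideal.Quotient.mk (Ideal.span {g})))).presheaf.stalk y,
            (∃ e : ℕ, z ^ 5 ^ e ∈ Ideal.span ((fun w : (affineBlowup ((Ideal.span {m : MvPolynomial (Fin 5) k |
              ∃ b : Fin 5 →₀ ℕ, 18 ≤ Finsupp.weight (![2, 3, 9, 3, 0] : Fin 5 → ℕ) b ∧ m = MvPolynomial.monomial b 1}).map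
                (Ideal.Quotient.mk (Ideal.span {g})))).presheaf.stalk y => w ^ 5 ^ e) ''
              (Ideal.span (Set.range s) : Set ((affineBlowup ((Ideal.span {m : MvPolynomial (Fin 5) k | ∃ b : Fin 5 →₀ ℕ,
                18 ≤ Finsupp.weight (![2, 3, 9, 3, 0] : Fin 5 → ℕ) b ∧ m = MvPolynomial.monomial b 1}).map
                  (Ideal.Quotient.mk (Ideal.span {g})))).presheaf.stalk y)))) →
            z ∈ Ideal.span (Set.range s) := by
  haveI : Fact (Nat.Prime 5) := ⟨by norm_num⟩
  exact FilteredConeFiModelRel.filteredConeFiModelRel_affineBlowup 5 k 5 ({0, 1, 2, 3} : Finset (Fin 5)) ⟨0, by simp⟩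
    ![2, 3, 9, 3, 0] 18 18 ![9, 6, 2, 6, 0] (by norm_num) hwc_2393 hw0_2393 (RelGddF008Hpow.hpow_2393_18 k) g g₀
    (by rw [RelGddF008Data.weightedHomogeneousComponent_eighteen k g hg, hg₀])
    (RelGddF008Data.weightedHomogeneousComponent_lt_eighteen k g hg) (hg₀ ▸ RelGddF008Data.g0_ne_zero k)
    (RelGddF008Data.span_g_isPrime k g hg) (RelGddF008Data.g_X_ne_zero k g hg) (RelGddF008Regular.g_offL_clause_char5 k g hg)
    (RelGddF008Cone.g0_offL_clause_char5 k g₀ hg₀)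

/-- **The `∃`-form for the diagonal form `g` at `p = 5`**: `Spec k[X]/(g)` admits a proper birational model all of
whose stalks are domains satisfying the per-stalk clause of the crux — the weighted blow-up of `I₁₈` along the `t`-axis. [folklore] -/
theorem g_relGdd_char5 (k : Type) [Field k] [CharP k 5] (g g₀ : MvPolynomial (Fin 5) k)
    (hg : g = X 2 ^ 2 + X 4 ^ 4 * X 3 ^ 6 + (X 1 ^ 2 + X 0 ^ 3) ^ 3 + X 4 * X 0 ^ 3 * X 1 * X 3 ^ 3 + X 0 ^ 11 + X 3 ^ 7)
    (hg₀ : g₀ = X 2 ^ 2 + X 4 ^ 4 * X 3 ^ 6 + (X 1 ^ 2 + X 0 ^ 3) ^ 3 + X 4 * X 0 ^ 3 * X 1 * X 3 ^ 3) :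
    ∃ (X' : Scheme.{0}) (π : X' ⟶ Spec (.of (MvPolynomial (Fin 5) k ⧸ Ideal.span {g}))), IsProper π ∧
      Literature.AlgebraicGeometry.Resolution.IsBirational π ∧
      ∀ y : X', IsDomain (X'.presheaf.stalk y) ∧ ∀ d : ℕ, ringKrullDim (X'.presheaf.stalk y) = d →
        ∀ s : Fin d → X'.presheaf.stalk y, (Ideal.span (Set.range s)).radical.IsMaximal →
          RingTheory.Sequence.IsWeaklyRegular (X'.presheaf.stalk y) (List.ofFn s) ∧
          ∀ z : X'.presheaf.stalk y, (∃ e : ℕ, z ^ 5 ^ e ∈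
              Ideal.span ((fun w : X'.presheaf.stalk y => w ^ 5 ^ e) ''
                (Ideal.span (Set.range s) : Set (X'.presheaf.stalk y)))) →
            z ∈ Ideal.span (Set.range s) := by
  haveI : Fact (Nat.Prime 5) := ⟨by norm_num⟩
  exact FilteredConeFiModelRel.filteredConeFiModelRel 5 k 5 ({0, 1, 2, 3} : Finset (Fin 5)) ⟨0, by simp⟩
    ![2, 3, 9, 3, 0] 18 18 ![9, 6, 2, 6, 0] (by norm_num) hwc_2393 hw0_2393 (RelGddF008Hpow.hpow_2393_18 k) g g₀
    (by rw [RelGddF008Data.weightedHomogeneousComponent_eighteen k g hg, hg₀])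
    (RelGddF008Data.weightedHomogeneousComponent_lt_eighteen k g hg) (hg₀ ▸ RelGddF008Data.g0_ne_zero k)
    (RelGddF008Data.span_g_isPrime k g hg) (RelGddF008Data.g_X_ne_zero k g hg) (RelGddF008Regular.g_offL_clause_char5 k g hg)
    (RelGddF008Cone.g0_offL_clause_char5 k g₀ hg₀)

/-- **The hole-#3 `∃`-clause (shape of `stub_confinedIsoStepStrongPlus`) at the generic point `η` of the `t`-axis on `Spec k[X]/(g)`**:
a proper birational integral model with Cohen–Macaulay stalks, an isomorphism off the closure of `η`, FULL at every
non-closed point over that closure. [folklore] -/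
theorem g_relGdd_strongPlusStep_char5 (k : Type) [Field k] [CharP k 5] (g g₀ : MvPolynomial (Fin 5) k)
    (hg : g = X 2 ^ 2 + X 4 ^ 4 * X 3 ^ 6 + (X 1 ^ 2 + X 0 ^ 3) ^ 3 + X 4 * X 0 ^ 3 * X 1 * X 3 ^ 3 + X 0 ^ 11 + X 3 ^ 7)
    (hg₀ : g₀ = X 2 ^ 2 + X 4 ^ 4 * X 3 ^ 6 + (X 1 ^ 2 + X 0 ^ 3) ^ 3 + X 4 * X 0 ^ 3 * X 1 * X 3 ^ 3)
    (η : ↥(Spec (.of (MvPolynomial (Fin 5) k ⧸ Ideal.span {g}))))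
    (hη : η.asIdeal = Ideal.span ((fun j : Fin 5 => Ideal.Quotient.mk (Ideal.span {g}) (MvPolynomial.X j)) ''
      (({0, 1, 2, 3} : Finset (Fin 5)) : Set (Fin 5)))) :
    ∃ (X₂ : Scheme.{0}) (π : X₂ ⟶ Spec (.of (MvPolynomial (Fin 5) k ⧸ Ideal.span {g}))), IsProper π ∧
      Literature.AlgebraicGeometry.Resolution.IsBirational π ∧
      IsIntegral X₂ ∧ (∀ x : X₂, (∀ d : ℕ, ringKrullDim (X₂.presheaf.stalk x) = d → ∀ s : Fin d → X₂.presheaf.stalk x,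
        (Ideal.span (Set.range s)).radical.IsMaximal → RingTheory.Sequence.IsWeaklyRegular (X₂.presheaf.stalk x) (List.ofFn s))) ∧
      IsIso (π ∣_ ⟨(closure ({η} : Set ↥(Spec (.of (MvPolynomial (Fin 5) k ⧸ Ideal.span {g})))))ᶜ, isClosed_closure.isOpen_compl⟩) ∧
      ∀ x : X₂, π.base x ∈ closure ({η} : Set ↥(Spec (.of (MvPolynomial (Fin 5) k ⧸ Ideal.span {g})))) → ¬ IsClosed ({x} : Set X₂) →
        (IsDomain (X₂.presheaf.stalk x) ∧ ∀ d : ℕ, ringKrullDim (X₂.presheaf.stalk x) = d → ∀ s : Fin d → X₂.presheaf.stalk x,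
          (Ideal.span (Set.range s)).radical.IsMaximal → RingTheory.Sequence.IsWeaklyRegular (X₂.presheaf.stalk x) (List.ofFn s) ∧
          ∀ t : X₂.presheaf.stalk x, (∃ e : ℕ, t ^ 5 ^ e ∈ Ideal.span ((fun z : X₂.presheaf.stalk x => z ^ 5 ^ e) ''
            (Ideal.span (Set.range s) : Set (X₂.presheaf.stalk x)))) → t ∈ Ideal.span (Set.range s)) := by
  haveI : Fact (Nat.Prime 5) := ⟨by norm_num⟩
  exact FilteredConeFiModelRel.filteredConeFiModelRel_strongPlusStep 5 k 5 ({0, 1, 2, 3} : Finset (Fin 5)) ⟨0, by simp⟩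
    ![2, 3, 9, 3, 0] 18 18 ![9, 6, 2, 6, 0] (by norm_num) hwc_2393 hw0_2393 (RelGddF008Hpow.hpow_2393_18 k) g g₀
    (by rw [RelGddF008Data.weightedHomogeneousComponent_eighteen k g hg, hg₀])
    (RelGddF008Data.weightedHomogeneousComponent_lt_eighteen k g hg) (hg₀ ▸ RelGddF008Data.g0_ne_zero k)
    (RelGddF008Data.span_g_isPrime k g hg) (RelGddF008Data.g_X_ne_zero k g hg) (RelGddF008Regular.g_offL_clause_char5 k g hg)
    (RelGddF008Cone.g0_offL_clause_char5 k g₀ hg₀)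
    η hη

/-- ★ **F008 — ONE WEIGHTED BLOW-UP ALONG THE `t`-AXIS**: over every field `k` of characteristic
`5`, the fourfold `X = Spec k[X₀,…,X₄]/(X₂² + (X₁² + X₀³)³ + X₀¹¹ + X₃⁷ + X₄X₀³X₁X₃³ + X₄²X₂X₃³)` (RGDD-L row F008: `T₁₁ + t·x³y·w³ +
t²·z·w³`, bad along the whole `t`-axis) admits a proper birational model all of whose stalks are domains in which every system of
parameters is a weakly regular sequence generating a Frobenius-closed ideal — the conclusion of `FrobeniusLadder.FInjectiveMacaulayfication`
for `X` — namely the `(2,3,9,3 | 0)`-weighted blow-up of `I₁₈` along the axis, transported from the diagonal form along the graded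
automorphism `z ↦ z + 2t²w³`. [OURS · mechanism folklore / tree engine `FilteredConeFiModelRel`] -/
theorem f008_fInjectiveMacaulayfication_char5 (k : Type) [Field k] [CharP k 5] (f : MvPolynomial (Fin 5) k)
    (hf : f = X 2 ^ 2 + (X 1 ^ 2 + X 0 ^ 3) ^ 3 + X 0 ^ 11 + X 3 ^ 7 + X 4 * X 0 ^ 3 * X 1 * X 3 ^ 3 + X 4 ^ 2 * X 2 * X 3 ^ 3) :
    ∃ (X' : Scheme.{0}) (π : X' ⟶ Spec (.of (MvPolynomial (Fin 5) k ⧸ Ideal.span {f}))), IsProper π ∧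
      Literature.AlgebraicGeometry.Resolution.IsBirational π ∧
      ∀ y : X', IsDomain (X'.presheaf.stalk y) ∧ ∀ d : ℕ, ringKrullDim (X'.presheaf.stalk y) = d →
        ∀ s : Fin d → X'.presheaf.stalk y, (Ideal.span (Set.range s)).radical.IsMaximal →
          RingTheory.Sequence.IsWeaklyRegular (X'.presheaf.stalk y) (List.ofFn s) ∧
          ∀ z : X'.presheaf.stalk y, (∃ e : ℕ, z ^ 5 ^ e ∈
              Ideal.span ((fun w : X'.presheaf.stalk y => w ^ 5 ^ e) ''
                (Ideal.span (Set.range s) : Set (X'.presheaf.stalk y)))) →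
            z ∈ Ideal.span (Set.range s) := by
  set g : MvPolynomial (Fin 5) k := X 2 ^ 2 + X 4 ^ 4 * X 3 ^ 6 + (X 1 ^ 2 + X 0 ^ 3) ^ 3 + X 4 * X 0 ^ 3 * X 1 * X 3 ^ 3 +
    X 0 ^ 11 + X 3 ^ 7 with hg
  obtain ⟨X', π, hπ, hbir, hst⟩ := g_relGdd_char5 k g _ hg rfl
  -- the coordinate change and the induced isomorphism of affine coordinate rings
  obtain ⟨σ, h0, h1, h2, h3, h4⟩ := RelGddF008Data.exists_sigma k
  have hσf : σ f = g := by rw [hf, hg]; exact RelGddF008Data.sigma_f008_eq k σ h0 h1 h2 h3 h4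
  have hmap : Ideal.span {g} = Ideal.map (σ : MvPolynomial (Fin 5) k →+* MvPolynomial (Fin 5) k) (Ideal.span {f}) := by
    rw [Ideal.map_span, Set.image_singleton]
    exact congrArg _ (congrArg _ hσf.symm)
  let e : (MvPolynomial (Fin 5) k ⧸ Ideal.span {f}) ≃+* (MvPolynomial (Fin 5) k ⧸ Ideal.span {g}) :=
    (Ideal.quotientEquivAlg (Ideal.span {f}) (Ideal.span {g}) σ hmap).toRingEquiv
  -- `Spec` of it: an isomorphism `Spec k[X]/(g) ⟶ Spec k[X]/(f)`
  let ι : Spec (.of (MvPolynomial (Fin 5) k ⧸ Ideal.span {g})) ⟶ Spec (.of (MvPolynomial (Fin 5) k ⧸ Ideal.span {f})) :=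
    Spec.map (CommRingCat.ofHom e.toRingHom)
  haveI : IsIso (CommRingCat.ofHom e.toRingHom) := (e.toCommRingCatIso).isIso_hom
  haveI hι : IsIso ι := inferInstance
  haveI : IsProper π := hπ
  refine ⟨X', π ≫ ι, inferInstance, ?_, hst⟩
  exact IsBirational.comp hbir (Literature.AlgebraicGeometry.HodgeTheory.isBirational_of_isIso ι)

end Summit.ResolutionOfSingularities.ResolutionOfSingularities.Theorems.FInjectiveMacaulayfication.RelGddF008

end
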